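import Summits.QuantumFields.BalabanUV.Beta.D1BFx.MixedTableMass

/-!
# `BalabanUV.Beta.D1BFx.T2TableMass` — road «BF-x» for binder row D1, junction (J1), the second-order BORDER table's letter AT THE COMB TABLES
# («COMB-T2-TABLE-MASS», the comb twin of this lineage's staged «SYMT2-MASS» and the companion of «COMB-MIXED-TABLE-MASS»): **THE n-LAW OF NODE 12's
# `T₂`-TABLE MASS — `vh2Abs (toSite r) L ≤ 50000 · d · (ell d L)³` FOR EVERY ROOT OFFSET IN THE BOX AND `1 ≤ L`; AT THE CENTRED ROOT
# `vh2Abs (ctr d n) n ≤ 50000 · d · ((2d+2)·n)³` (`≍ n³`; at the road's `d = 4`: `≤ 2·10⁸·n³`)**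

HONEST DEPENDENCY (cell records, verbatim): «continuum YM on T⁴ ⇐ BetaPertH ∧ nine spine estimates (0/9 proved); BetaPertH ⇐ (D1) ∧ (D4) ∧
CAP+tail; G-an2-4 gates asym, D1 and NE2/3/4.»  HONEST FRAMING (cell contract, verbatim): «discharging `BetaPertH` makes Bałaban's UV stability
UNCONDITIONAL — a real constructive-QFT result; it is NOT the continuum limit and NOT the Clay problem.»  THIS MODULE DISCHARGES NOTHING of the
wall: [folklore] bookkeeping BY NAME over lit node 12 ∕ 12b's `vh2Abs ∕ vh2Tab ∕ T2At ∕ QjetAt ∕ PhiRAt ∕ PhiGAt ∕ map_PhiGAt ∕ Gf ∕ Gb ∕ Ebg ∕ Ebi ∕ upF ∕ ι ∕ bondSet`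
(`AveragingMixedJetTables`, `AveragingThirdJet`), lit node 12's truncated calculus (`expT ∕ logT ∕ invT ∕ mapDual ∕ map_logT ∕ map_invT`) and this lineage's
FILES 1–5 + «COMB-MIXED-TABLE-MASS» (`TruncatedAlgebraNorms ∕ WeightedRowSumNorm ∕ WordRecordingAlgebra ∕ SymMixedJetRecording ∕ SymMixedTableMass ∕ MixedTableMass`:
the seminorm letters, the recording algebra, `lvW`, `sum_three_le`, `sum_bondSet_cube_eq`, and the comb (42)-averaging step `PhiGAt_sub_one_le` — ONE loop family
`loopCAt`, weight `(L^d)⁻¹`); kernel lane: 0 def, 0 cite, 0 `def … : Prop`, 0 sorry, NO hypothesis displayed, default heartbeats.  A TABLE-MASS LETTER for the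
road's second-order border table re-instantiated at the COMB scheme — an2 g55's RULING R-D1-g55-1 (direction RE-TABLE FINAL: the road carries `vh₂S := vh₂SAn1`,
the anti-twin packing of node 12b's `vh₂SAt ρ_c`, whose localisation constant is `vh2Abs ρ_c L`, lit `biLoc_vh₂SAt`; the same constant is DISPLAYED in the row's
`SecondOrderTableLawEnd.locStencil₂_vh₂SAn1` and as the hypothesis `hB₂b : ∀ m, vh2Abs (toSite (r m)) L ≤ B₂` of an2's `CompositeVertexKernelBoundsTwo.locStencil₂_compVh2S_rooted`):
it prices NO word by itself and proves NO (1.22) row; nothing of Bałaban's asserted or valued; no value of any table asserted; 0 root-level binders of row D1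
discharged (hW ∕ hR-sockets ∕ hSX-socket ∕ D1Tel ∕ D1Rep = 0); (J1) ONE OPEN ROW (RE-TABLE's viability (B) pending by value); (K) NOT closed; NOT D1, NEVER
«G-an2-4 closed», NOT `BetaPertH`, NOT continuum, NOT Clay.

ABSOLUTE RULE (cell charter, verbatim): «No internally-minted statement may enter as a cited fact. Every hypothesis is either kernel-proved in
this package or a verbatim quotation of a PUBLISHED theorem with page reference. The manuscript(s) under audit are NOT citable for their own
disputed steps — they are the thing under adjudication; programme-internal (2001/route/tribunal) claims are never citable.»

WHY ∕ HOW.  `vh2Abs ρ L = Σ_μ Σ_{(f,g,h) ∈ bondSet³} |s(f; g, h)|` with `s(f; g, h)` the coefficient of `B_g B′_h W_f` in node 12's symmetric second-order background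
response `T2At = c11 Qjet(ω,B,B′) + c11 Qjet(ω,B′,B)` on the PRODUCT chart `U_f = (1 + ρ ω̂_f)·E_f`, `E_f = e^{τ₁B_f}e^{τ₂B′_f}` (lit `vh2Tab`).  By §1–§2, `s(w₃; w₁, w₂)`
is the top-row entry `X_{•,(w₁,w₂,w₃)}` of ONE element `X = T2At ℚ ρ (upF (2→3)♭) W♭ (1→2)♭` of FILE 3's recording algebra; by §3 the product chart's letters obey
`ν₃(U_f − 1) ≤ (1+t)³ − 1` when `ν₂ ω̂ ≤ t`, `ν B, ν B′ ≤ t`; the comb (42)-averaging step `PhiGAt_sub_one_le` («COMB-MIXED-TABLE-MASS» §2) and FILE 1's chain give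
`ν(c11 Qjet) ≤ Kmix β`, hence `ν(T2At) ≤ 2·Kmix β ≤ 16∕5` at `t = 1∕(25·ell)`, and the weighted row-sum norm turns this into the top-row mass `≤ 2 · 25000 · ell³`
(§4); summing the `d` directions gives `50000·d·ell³`.  The numeral is honest and crude; only the LAW `≍ ell³ ≍ n³` is the point — the SAME law as the
symmetrised table's (staged OFFER «SYMT2-MASS»), by construction.

CONTENT ([folklore] throughout).  §1 `mapDual²` ∕ `mapDual³` on node 12's chart letters (`c00∕c10∕c01_mapDual2`, `mapDual2_Ebg ∕ _Ebi`, `mapDual3_Gf ∕ _Gb`,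
`mapDual2_upF`), `mapDual3_PhiRAt`, `c11_QjetAt_map`, **`T2At_map`** (naturality of node 12's `T2At` under `ℚ`-algebra homomorphisms); §2 **`vh2Tab_eq_entry`**
(`s(w₃; w₁, w₂) = X_{•,(w₁,w₂,w₃)}`); §3 the product-chart letters `tauRS_Ebg_sub_one_le`, `tauRS_upF_le`, `tauRS_zero_form_le`, **`rhoRS_Gf_sub_one_le ∕
rhoRS_Gb_sub_one_le`**, **`norm_T2At_le`** (`ν (T2At) ≤ 2·Kmix β`); §4 **`sum_abs_entry_T2_le`** (top-row mass `≤ 50000·ell³`), **`vh2Abs_le`**, **`vh2Abs_ctr_le`**,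
`vh2Abs_ctr4_le` (`d = 4`: `≤ 2·10⁸·n³`).
NOT HERE (honest): any row at the comb `T₂` table (the road's RETABLE-SPEC ∕ WANTED); the bridge to an2's `hB₂b` (the consumer's one line); the comb first-order ∕
`H` tables (gan24-leaf-05's ∕ d1-leaf-03's comb lane); the symmetrised twin `symVh2Abs` (staged OFFER «SYMT2-MASS», not in the tree); per-`μ` variants.
Unit `b2b-balaban-beta-d1-formalise-leaf-04` (gen 32), D1 formalisation swarm LEAF PROVER 04, road «BF-x» supplier; INTENT I-leaf04-g32-1 «COMB-T2-TABLE-MASS»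
(journal).  Not in print; our bookkeeping.  No existing file touched.
-/

noncomputable section

open Finset
open scoped BigOperators Nat
open Literature.MathematicalPhysics.QuantumFieldTheory.Balaban1983to89.Beta
open Literature.MathematicalPhysics.QuantumFieldTheory.Balaban1983to89.Beta.AffineAveraging
open Literature.MathematicalPhysics.QuantumFieldTheory.Balaban1983to89.Beta.AveragingContours
open Literature.MathematicalPhysics.QuantumFieldTheory.Balaban1983to89.Beta.AveragingContoursRooted
open Literature.MathematicalPhysics.QuantumFieldTheory.Balaban1983to89.Beta.AveragingHessianKernels
open Literature.MathematicalPhysics.QuantumFieldTheory.Balaban1983to89.Beta.AveragingThirdJet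
open Literature.MathematicalPhysics.QuantumFieldTheory.Balaban1983to89.Beta.AveragingThirdJet.Tau
open Literature.MathematicalPhysics.QuantumFieldTheory.Balaban1983to89.Beta.AveragingMixedJetTables
open Summit.QuantumFields.BalabanUV.Beta.SymAveragingMixedJetTables
open Summit.QuantumFields.BalabanUV.Beta.D1BFx.TruncatedAlgebraNorms
open Summit.QuantumFields.BalabanUV.Beta.D1BFx.WeightedRowSumNorm
open Summit.QuantumFields.BalabanUV.Beta.D1BFx.WordRecordingAlgebra
open Summit.QuantumFields.BalabanUV.Beta.D1BFx.SymMixedJetRecording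
open Summit.QuantumFields.BalabanUV.Beta.D1BFx.SymMixedTableMass
open Summit.QuantumFields.BalabanUV.Beta.D1BFx.MixedTableMass

namespace Summit.QuantumFields.BalabanUV.Beta.D1BFx.T2TableMass

/-! ## §1 Naturality of node 12's second-order background response on the product chart -/

section Naturality

variable {d : ℕ} {𝔸 𝔸' : Type*} [Ring 𝔸] [Algebra ℚ 𝔸] [Ring 𝔸'] [Algebra ℚ 𝔸'] (ψ : 𝔸 →ₐ[ℚ] 𝔸')

/-- [folklore] The four components of `mapDual²` (by `rfl`). -/
theorem c00_mapDual2 (q : Tau 𝔸) : c00 (mapDual (mapDual ψ) q) = ψ (c00 q) := rfl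
/-- [folklore] -/
theorem c10_mapDual2 (q : Tau 𝔸) : c10 (mapDual (mapDual ψ) q) = ψ (c10 q) := rfl
/-- [folklore] -/
theorem c01_mapDual2 (q : Tau 𝔸) : c01 (mapDual (mapDual ψ) q) = ψ (c01 q) := rfl

/-- [folklore] `mapDual²` on the ordered background letter `E_f = e^{τ₁B_f}e^{τ₂B′_f}`. -/
theorem mapDual2_Ebg (B B' : Form1 d 𝔸) (κ : Fin d) (x : Fin d → ℤ) :
    mapDual (mapDual ψ) (Ebg B B' κ x) = Ebg (fun κ x => ψ (B κ x)) (fun κ x => ψ (B' κ x)) κ x :=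
  ext4 (by rw [c00_mapDual2, c00_Ebg, c00_Ebg, map_one]) (by rw [c10_mapDual2, c10_Ebg, c10_Ebg])
    (by rw [c01_mapDual2, c01_Ebg, c01_Ebg]) (by rw [c11_mapDual2, c11_Ebg, c11_Ebg, map_mul])

/-- [folklore] `mapDual²` on `E_f⁻¹`. -/
theorem mapDual2_Ebi (B B' : Form1 d 𝔸) (κ : Fin d) (x : Fin d → ℤ) :
    mapDual (mapDual ψ) (Ebi B B' κ x) = Ebi (fun κ x => ψ (B κ x)) (fun κ x => ψ (B' κ x)) κ x :=
  ext4 (by rw [c00_mapDual2, c00_Ebi, c00_Ebi, map_one]) (by rw [c10_mapDual2, c10_Ebi, c10_Ebi, map_neg])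
    (by rw [c01_mapDual2, c01_Ebi, c01_Ebi, map_neg]) (by rw [c11_mapDual2, c11_Ebi, c11_Ebi, map_mul])

/-- [folklore] `mapDual³` on the forward transporter of node 12's product chart. -/
theorem mapDual3_Gf (ω : Form1 d (Tau 𝔸)) (B B' : Form1 d 𝔸) (κ : Fin d) (x : Fin d → ℤ) :
    mapDual (mapDual (mapDual ψ)) (Gf ω B B' κ x)
      = Gf (fun κ x => mapDual (mapDual ψ) (ω κ x)) (fun κ x => ψ (B κ x)) (fun κ x => ψ (B' κ x)) κ x := by
  apply TrivSqZeroExt.ext <;> simp [mapDual2_Ebg, map_mul]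

/-- [folklore] `mapDual³` on the backward transporter of node 12's product chart. -/
theorem mapDual3_Gb (ω : Form1 d (Tau 𝔸)) (B B' : Form1 d 𝔸) (κ : Fin d) (x : Fin d → ℤ) :
    mapDual (mapDual (mapDual ψ)) (Gb ω B B' κ x)
      = Gb (fun κ x => mapDual (mapDual ψ) (ω κ x)) (fun κ x => ψ (B κ x)) (fun κ x => ψ (B' κ x)) κ x := by
  apply TrivSqZeroExt.ext <;> simp [mapDual2_Ebi, map_mul, map_neg]

/-- [folklore] NATURALITY of node 12's rooted comb averaging on the product chart (lit `map_PhiGAt` BY NAME). -/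
theorem mapDual3_PhiRAt (ρ : Fin d → ℤ) (ω : Form1 d (Tau 𝔸)) (B B' : Form1 d 𝔸) (L : ℕ) (μ : Fin d) (y : Fin d → ℤ) :
    mapDual (mapDual (mapDual ψ)) (PhiRAt ℚ ρ ω B B' L μ y)
      = PhiRAt ℚ ρ (fun κ x => mapDual (mapDual ψ) (ω κ x)) (fun κ x => ψ (B κ x)) (fun κ x => ψ (B' κ x)) L μ y := by
  rw [PhiRAt, PhiRAt, map_PhiGAt]
  simp only [mapDual3_Gf, mapDual3_Gb]

set_option synthInstance.maxHeartbeats 40000 in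
/-- [folklore] NATURALITY of the `τ₁τ₂`-coefficient of node 12's rooted averaged jet.
(The `Mul (Rho 𝔸′)` instance search on the `map_logT` line needs between 17 000 and 20 000 of the default 20 000 `synthInstance` heartbeats on the check
farm — the hub build's overhead class, measured by a global-cap probe; the scoped option above doubles the budget, as in FILE 4 v1.1's `symMjetAt_map` and
«COMB-MIXED-TABLE-MASS»'s `MjetAt_map`.) -/
theorem c11_QjetAt_map (ρ : Fin d → ℤ) (ω : Form1 d (Tau 𝔸)) (B B' : Form1 d 𝔸) (L : ℕ) (μ : Fin d) (y : Fin d → ℤ) :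
    ψ (c11 (QjetAt ℚ ρ ω B B' L μ y))
      = c11 (QjetAt ℚ ρ (fun κ x => mapDual (mapDual ψ) (ω κ x)) (fun κ x => ψ (B κ x)) (fun κ x => ψ (B' κ x)) L μ y) := by
  have h0 : (fun κ x => mapDual (mapDual ψ) ((0 : Form1 d (Tau 𝔸)) κ x)) = (0 : Form1 d (Tau 𝔸')) := by funext κ x; simp
  have e := congrArg (fun Z : Rho 𝔸' => c11 Z.snd)
    (map_logT (mapDual (mapDual (mapDual ψ))) (PhiRAt ℚ ρ ω B B' L μ y * invT (PhiRAt ℚ ρ 0 B B' L μ y)))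
  simp only [map_mul, map_invT, mapDual3_PhiRAt, h0, snd_mapDual, c11_mapDual2] at e
  rw [QjetAt, QjetAt]; exact e

/-- [folklore] **NATURALITY OF NODE 12's `T2At`** under `ℚ`-algebra homomorphisms: `ψ (T₂(ω; B, B′)) = T₂(ψω; ψB, ψB′)`. -/
theorem T2At_map (ρ : Fin d → ℤ) (ω : Form1 d (Tau 𝔸)) (B B' : Form1 d 𝔸) (L : ℕ) (μ : Fin d) (y : Fin d → ℤ) :
    ψ (T2At ℚ ρ ω B B' L μ y)
      = T2At ℚ ρ (fun κ x => mapDual (mapDual ψ) (ω κ x)) (fun κ x => ψ (B κ x)) (fun κ x => ψ (B' κ x)) L μ y := by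
  rw [T2At, T2At, map_add, c11_QjetAt_map, c11_QjetAt_map]

/-- [folklore] `mapDual² ∘ upF W = upF (ψ ∘ W)`. -/
theorem mapDual2_upF (W : Form1 d 𝔸) : (fun κ x => mapDual (mapDual ψ) (upF W κ x)) = upF (fun κ x => ψ (W κ x)) := by
  funext κ x; rw [upF_apply, upF_apply, mapDual2_ι]

end Naturality

/-! ## §2 Node 12's second-order background table as entries of ONE recording-algebra element -/

section Identification

variable {d : ℕ} (ρ : Fin d → ℤ) (L : ℕ) (μ : Fin d)

/-- [folklore] **`s(w₃; w₁, w₂) = X_{•,(w₁,w₂,w₃)}`** for `X := T2At ℚ ρ (upF (2→3)♭) W♭ (1→2)♭` in the recording algebra (any root). -/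
theorem vh2Tab_eq_entry (w : SB d L × SB d L × SB d L) :
    (vh2Tab ρ L μ 0 (w.2.2 : Bond d) (w.1 : Bond d) (w.2.1 : Bond d) : ℚ)
      = ((T2At ℚ ρ (upF (rec23 d L)) (recW d L) (rec12 d L) L μ 0 : recAlg (SB d L)) : Matrix (Idx (SB d L)) (Idx (SB d L)) ℚ)
          Idx.nil (Idx.three w.1 w.2.1 w.2.2) := by
  have e := T2At_map (theta w) ρ (upF (rec23 d L)) (recW d L) (rec12 d L) L μ 0
  rw [mapDual2_upF, theta_recW, theta_rec12, theta_rec23] at e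
  have e03 := congrFun (congrFun e 0) 3
  rw [theta_apply] at e03
  rw [vh2Tab, ← e03]; rfl

end Identification

/-! ## §3 The chart letters of node 12's product chart in the `Rho` lift; `T2At` in norm -/

section Chain

variable {d : ℕ} {𝔸 : Type*} [Ring 𝔸] [Algebra ℚ 𝔸] (ν : RingSeminorm 𝔸)

omit [Algebra ℚ 𝔸] in
/-- [folklore] `ν₂ (E_f − 1) ≤ 2t + t²` and `ν₂ (E_f⁻¹ − 1) ≤ 2t + t²` from `ν B, ν B′ ≤ t`. -/
theorem tauRS_Ebg_sub_one_le {t : ℝ} (ht : 0 ≤ t) {B B' : Form1 d 𝔸} (hB : ∀ κ x, ν (B κ x) ≤ t) (hB' : ∀ κ x, ν (B' κ x) ≤ t)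
    (κ : Fin d) (x : Fin d → ℤ) :
    tauRS ν (Ebg B B' κ x - 1) ≤ 2 * t + t ^ 2 ∧ tauRS ν (Ebi B B' κ x - 1) ≤ 2 * t + t ^ 2 := by
  have h1 := (map_mul_le_mul ν (B κ x) (B' κ x)).trans (mul_le_mul (hB κ x) (hB' κ x) (apply_nonneg ν _) ht)
  have h2 := (map_mul_le_mul ν (B' κ x) (B κ x)).trans (mul_le_mul (hB' κ x) (hB κ x) (apply_nonneg ν _) ht)
  constructor
  · rw [tauRS_apply]
    simp only [c00_sub, c10_sub, c01_sub, c11_sub, c00_Ebg, c10_Ebg, c01_Ebg, c11_Ebg, c00_one, c10_one, c01_one, c11_one, sub_self, sub_zero, map_zero]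
    nlinarith [hB κ x, hB' κ x]
  · rw [tauRS_apply]
    simp only [c00_sub, c10_sub, c01_sub, c11_sub, c00_Ebi, c10_Ebi, c01_Ebi, c11_Ebi, c00_one, c10_one, c01_one, c11_one, sub_self, sub_zero,
      map_zero, map_neg_eq_map]
    nlinarith [hB κ x, hB' κ x]

omit [Algebra ℚ 𝔸] in
/-- [folklore] `ν₂ (upF W)_f ≤ t` from `ν W_f ≤ t`. -/
theorem tauRS_upF_le {W : Form1 d 𝔸} {t : ℝ} (hW : ∀ κ x, ν (W κ x) ≤ t) (κ : Fin d) (x : Fin d → ℤ) : tauRS ν (upF W κ x) ≤ t := by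
  rw [upF_apply, tauRS_apply]; simp only [c00_ι, c10_ι, c01_ι, c11_ι, map_zero, add_zero]; exact hW κ x

omit [Algebra ℚ 𝔸] in
/-- [folklore] `ν₂ 0_f ≤ t` for `0 ≤ t`. -/
theorem tauRS_zero_form_le {t : ℝ} (ht : 0 ≤ t) (κ : Fin d) (x : Fin d → ℤ) : tauRS ν ((0 : Form1 d (Tau 𝔸)) κ x) ≤ t := by
  rw [Pi.zero_apply, Pi.zero_apply, map_zero]; exact ht

omit [Algebra ℚ 𝔸] in
/-- [folklore] **THE PRODUCT-CHART LETTERS**: with `ν₂ ω̂_f ≤ t` and `ν B_f, ν B′_f ≤ t`: `ν₃ (U_f − 1) ≤ (1+t)³ − 1` (forward). -/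
theorem rhoRS_Gf_sub_one_le {t : ℝ} (ht : 0 ≤ t) {ω : Form1 d (Tau 𝔸)} {B B' : Form1 d 𝔸}
    (hω : ∀ κ x, tauRS ν (ω κ x) ≤ t) (hB : ∀ κ x, ν (B κ x) ≤ t) (hB' : ∀ κ x, ν (B' κ x) ≤ t) (κ : Fin d) (x : Fin d → ℤ) :
    rhoRS ν (Gf ω B B' κ x - 1) ≤ (1 + t) ^ 3 - 1 := by
  have hE := (tauRS_Ebg_sub_one_le ν ht hB hB' κ x).1
  have hX : rhoRS ν (dmk (1 : Tau 𝔸) (ω κ x) - 1) ≤ t := by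
    rw [rhoRS_apply]
    simp only [TrivSqZeroExt.fst_sub, TrivSqZeroExt.snd_sub, fst_dmk, snd_dmk, TrivSqZeroExt.fst_one, TrivSqZeroExt.snd_one, sub_self, sub_zero,
      map_zero, zero_add]
    exact hω κ x
  have hY : rhoRS ν (dmk (Ebg B B' κ x) (0 : Tau 𝔸) - 1) ≤ 2 * t + t ^ 2 := by
    rw [rhoRS_apply]
    simp only [TrivSqZeroExt.fst_sub, TrivSqZeroExt.snd_sub, fst_dmk, snd_dmk, TrivSqZeroExt.fst_one, TrivSqZeroExt.snd_one, sub_zero, map_zero,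
      add_zero]
    exact hE
  rw [Gf]
  refine (mul_sub_one_le (rhoRS ν) hX hY).trans (le_of_eq ?_)
  ring

omit [Algebra ℚ 𝔸] in
/-- [folklore] … and `ν₃ (U_f⁻¹ − 1) ≤ (1+t)³ − 1` (backward). -/
theorem rhoRS_Gb_sub_one_le {t : ℝ} (ht : 0 ≤ t) {ω : Form1 d (Tau 𝔸)} {B B' : Form1 d 𝔸}
    (hω : ∀ κ x, tauRS ν (ω κ x) ≤ t) (hB : ∀ κ x, ν (B κ x) ≤ t) (hB' : ∀ κ x, ν (B' κ x) ≤ t) (κ : Fin d) (x : Fin d → ℤ) :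
    rhoRS ν (Gb ω B B' κ x - 1) ≤ (1 + t) ^ 3 - 1 := by
  have hE := (tauRS_Ebg_sub_one_le ν ht hB hB' κ x).2
  have hX : rhoRS ν (dmk (1 : Tau 𝔸) (-ω κ x) - 1) ≤ t := by
    rw [rhoRS_apply]
    simp only [TrivSqZeroExt.fst_sub, TrivSqZeroExt.snd_sub, fst_dmk, snd_dmk, TrivSqZeroExt.fst_one, TrivSqZeroExt.snd_one, sub_self, sub_zero,
      map_zero, zero_add, map_neg_eq_map]
    exact hω κ x
  have hY : rhoRS ν (dmk (Ebi B B' κ x) (0 : Tau 𝔸) - 1) ≤ 2 * t + t ^ 2 := by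
    rw [rhoRS_apply]
    simp only [TrivSqZeroExt.fst_sub, TrivSqZeroExt.snd_sub, fst_dmk, snd_dmk, TrivSqZeroExt.fst_one, TrivSqZeroExt.snd_one, sub_zero, map_zero,
      add_zero]
    exact hE
  rw [Gb]
  refine (mul_sub_one_le (rhoRS ν) hY hX).trans (le_of_eq ?_)
  ring

/-- [folklore] **NODE 12's `T₂` IN NORM**: `ν (T2At ω B B′) ≤ 2·Kmix β` under the product-chart letter bounds for `(ω,B,B′)`, `(0,B,B′)`, `(ω,B′,B)`, `(0,B′,B)`
and `m^ell − 1 ≤ β` — two ordered jets, each through the COMB averaging step «COMB-MIXED-TABLE-MASS» `PhiGAt_sub_one_le` and FILE 1's chain. -/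
theorem norm_T2At_le (h1 : ν 1 ≤ 1) (hs : ∀ (c : ℚ) (y : 𝔸), ν (algebraMap ℚ 𝔸 c * y) ≤ |(c : ℝ)| * ν y) {m β : ℝ} (hm : 1 ≤ m)
    {ω : Form1 d (Tau 𝔸)} {B B' : Form1 d 𝔸}
    (hU : ∀ κ x, rhoRS ν (Gf ω B B' κ x - 1) ≤ m - 1) (hUb : ∀ κ x, rhoRS ν (Gb ω B B' κ x - 1) ≤ m - 1)
    (hE : ∀ κ x, rhoRS ν (Gf 0 B B' κ x - 1) ≤ m - 1) (hEb : ∀ κ x, rhoRS ν (Gb 0 B B' κ x - 1) ≤ m - 1)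
    (hU' : ∀ κ x, rhoRS ν (Gf ω B' B κ x - 1) ≤ m - 1) (hUb' : ∀ κ x, rhoRS ν (Gb ω B' B κ x - 1) ≤ m - 1)
    (hE' : ∀ κ x, rhoRS ν (Gf 0 B' B κ x - 1) ≤ m - 1) (hEb' : ∀ κ x, rhoRS ν (Gb 0 B' B κ x - 1) ≤ m - 1)
    {L : ℕ} (hL : 1 ≤ L) {r : Fin d → ℕ} (hr : r ∈ box d L) (hβ : m ^ ell d L - 1 ≤ β) (μ : Fin d) (y : Fin d → ℤ) :
    ν (T2At ℚ (toSite r) ω B B' L μ y) ≤ 2 * Kmix β := by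
  have key : ∀ {ω₁ : Form1 d (Tau 𝔸)} {B₁ B₁' : Form1 d 𝔸},
      (∀ κ x, rhoRS ν (Gf ω₁ B₁ B₁' κ x - 1) ≤ m - 1) → (∀ κ x, rhoRS ν (Gb ω₁ B₁ B₁' κ x - 1) ≤ m - 1) →
      (∀ κ x, rhoRS ν (Gf 0 B₁ B₁' κ x - 1) ≤ m - 1) → (∀ κ x, rhoRS ν (Gb 0 B₁ B₁' κ x - 1) ≤ m - 1) →
      ν (c11 (QjetAt ℚ (toSite r) ω₁ B₁ B₁' L μ y)) ≤ Kmix β := by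
    intro ω₁ B₁ B₁' hU₁ hUb₁ hE₁ hEb₁
    have hΦU : rhoRS ν (PhiRAt ℚ (toSite r) ω₁ B₁ B₁' L μ y - 1) ≤ phiC β :=
      PhiGAt_sub_one_le (rhoRS ν) (rhoRS_one_le ν h1) (rhoRS_smul_le ν hs) hm hU₁ hUb₁ hL hr hβ μ y
    have hΦE : rhoRS ν (PhiRAt ℚ (toSite r) 0 B₁ B₁' L μ y - 1) ≤ phiC β :=
      PhiGAt_sub_one_le (rhoRS ν) (rhoRS_one_le ν h1) (rhoRS_smul_le ν hs) hm hE₁ hEb₁ hL hr hβ μ y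
    have hinv := invT_sub_one_le (rhoRS ν) hΦE
    have hprod := mul_sub_one_le (rhoRS ν) hΦU hinv
    have hlog := logT_le (rhoRS ν) (rhoRS_smul_le ν hs) hprod
    rw [QjetAt]
    exact (c11_snd_le_rhoRS ν _).trans hlog
  rw [T2At]
  refine (map_add_le_add ν _ _).trans ?_
  linarith [key hU hUb hE hEb, key hU' hUb' hE' hEb']

end Chain

/-! ## §4 The recording algebra at `t = 1∕(25·ell)` and THE LETTER: `vh2Abs (toSite r) L ≤ 50000 · d · ell³` -/

section Mass

variable {d L : ℕ}

/-- [folklore] **TOP-ROW MASS of the recording-algebra `T₂`**: `Σ_{w ∈ S³} |X_{•,(w)}| ≤ 50000·ell³` for `X := T2At ℚ ρ (upF (2→3)♭) W♭ (1→2)♭`. -/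
theorem sum_abs_entry_T2_le (hL : 1 ≤ L) {r : Fin d → ℕ} (hr : r ∈ box d L) (μ : Fin d) :
    ∑ w : SB d L × SB d L × SB d L,
        |(((T2At ℚ (toSite r) (upF (rec23 d L)) (recW d L) (rec12 d L) L μ 0 : recAlg (SB d L)) :
          Matrix (Idx (SB d L)) (Idx (SB d L)) ℚ) Idx.nil (Idx.three w.1 w.2.1 w.2.2) : ℝ)| ≤ 50000 * (ell d L : ℝ) ^ 3 := by
  have hell : (1 : ℝ) ≤ ell d L := by unfold ell; exact_mod_cast (show 1 ≤ (2 * d + 2) * L by nlinarith)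
  obtain ⟨t, ht_def⟩ : ∃ t : ℝ, t = 1 / (25 * ell d L) := ⟨_, rfl⟩
  have ht : 0 < t := by rw [ht_def]; positivity
  obtain ⟨ν, hν_def⟩ : ∃ ν : RingSeminorm (recAlg (SB d L)), ν = restrictRS (mnormRS (lvW_pos ht)) (recAlg (SB d L)) := ⟨_, rfl⟩
  have hν : ∀ x : recAlg (SB d L), ν x = mnorm (lvW t) (x : Matrix (Idx (SB d L)) (Idx (SB d L)) ℚ) := fun x => by
    rw [hν_def, restrictRS_apply, mnormRS_apply]
  have h1 : ν 1 ≤ 1 := by rw [hν, OneMemClass.coe_one]; exact mnorm_one_le (lvW_pos ht)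
  have hs : ∀ (c : ℚ) (y : recAlg (SB d L)), ν (algebraMap ℚ (recAlg (SB d L)) c * y) ≤ |(c : ℝ)| * ν y := fun c y => by
    rw [hν, hν, MulMemClass.coe_mul, Subalgebra.coe_algebraMap]; exact mnorm_smul_le (lvW_pos ht) c _
  have hWν : ∀ κ x, ν (recW d L κ x) ≤ t := fun κ x => by rw [hν]; exact mnorm_recW_le ht κ x
  have h12 : ∀ κ x, ν (rec12 d L κ x) ≤ t := fun κ x => by rw [hν]; exact mnorm_rec12_le ht κ x
  have h23' : ∀ κ x, ν (rec23 d L κ x) ≤ t := fun κ x => by rw [hν]; exact mnorm_rec23_le ht κ x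
  have h23 := tauRS_upF_le ν h23'
  have h0 := tauRS_zero_form_le ν ht.le (d := d)
  have hm : (1 : ℝ) ≤ (1 + t) ^ 3 := one_le_pow₀ (by linarith)
  -- m^ell − 1 ≤ 3/22 at t = 1/(25 ell)
  have hβ : ((1 + t) ^ 3) ^ ell d L - 1 ≤ 3 / 22 := by
    have e1 : ((1 + t) ^ 3) ^ ell d L = (1 + t) ^ (3 * ell d L) := by rw [pow_mul]
    have e2 : ((3 * ell d L : ℕ) : ℝ) * t = 3 / 25 := by rw [ht_def]; push_cast; field_simp
    have e3 := one_add_pow_le ht.le (n := 3 * ell d L) (by rw [e2]; norm_num)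
    rw [e2] at e3
    rw [e1]; linarith [show (1 : ℝ) / (1 - 3 / 25) = 25 / 22 by norm_num]
  have hX : ν (T2At ℚ (toSite r) (upF (rec23 d L)) (recW d L) (rec12 d L) L μ 0) ≤ 2 * (8 / 5) :=
    (norm_T2At_le ν h1 hs hm
      (rhoRS_Gf_sub_one_le ν ht.le h23 hWν h12) (rhoRS_Gb_sub_one_le ν ht.le h23 hWν h12)
      (rhoRS_Gf_sub_one_le ν ht.le h0 hWν h12) (rhoRS_Gb_sub_one_le ν ht.le h0 hWν h12)
      (rhoRS_Gf_sub_one_le ν ht.le h23 h12 hWν) (rhoRS_Gb_sub_one_le ν ht.le h23 h12 hWν)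
      (rhoRS_Gf_sub_one_le ν ht.le h0 h12 hWν) (rhoRS_Gb_sub_one_le ν ht.le h0 h12 hWν) hL hr hβ μ 0).trans
      (by linarith [Kmix_num])
  rw [hν] at hX
  have hrow := sum_three_le ht ((T2At ℚ (toSite r) (upF (rec23 d L)) (recW d L) (rec12 d L) L μ 0 : recAlg (SB d L)) :
    Matrix (Idx (SB d L)) (Idx (SB d L)) ℚ)
  have key := hrow.trans hX
  have ht3 : t ^ 3 * (15625 * (ell d L : ℝ) ^ 3) = 1 := by rw [ht_def]; field_simp; norm_num
  have hpos : 0 < 15625 * (ell d L : ℝ) ^ 3 := by positivity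
  have hS : 0 ≤ ∑ w : SB d L × SB d L × SB d L,
      |(((T2At ℚ (toSite r) (upF (rec23 d L)) (recW d L) (rec12 d L) L μ 0 : recAlg (SB d L)) :
        Matrix (Idx (SB d L)) (Idx (SB d L)) ℚ) Idx.nil (Idx.three w.1 w.2.1 w.2.2) : ℝ)| := Finset.sum_nonneg fun _ _ => abs_nonneg _
  nlinarith

/-- [folklore] **THE n-LAW OF NODE 12's `vh2Abs` (the reference-block `ℓ¹` mass of the comb `T₂` table `s`)**: for every root offset in the box and
`1 ≤ L`, `vh2Abs (toSite r) L ≤ 50000 · d · (ell d L)³` (`ell d L = (2d+2)·L`). No hypothesis on any table; no value asserted. -/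
theorem vh2Abs_le (hL : 1 ≤ L) {r : Fin d → ℕ} (hr : r ∈ box d L) :
    vh2Abs (toSite r) L ≤ 50000 * d * (ell d L : ℝ) ^ 3 := by
  -- the permutation of the alphabet cube used to re-index the word of `s`
  let e : SB d L × SB d L × SB d L ≃ SB d L × SB d L × SB d L :=
    { toFun := fun w => (w.2.1, w.2.2, w.1), invFun := fun w => (w.2.2, w.1, w.2.1), left_inv := fun _ => rfl, right_inv := fun _ => rfl }
  have hμ : ∀ μ : Fin d, ∑ p ∈ (bondSet d L ×ˢ bondSet d L) ×ˢ bondSet d L,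
      |(vh2Tab (toSite r) L μ 0 p.1.1 p.1.2 p.2 : ℝ)| ≤ 50000 * (ell d L : ℝ) ^ 3 := by
    intro μ
    rw [sum_bondSet_cube_eq (fun f g h => |(vh2Tab (toSite r) L μ 0 f g h : ℝ)|)]
    set X := ((T2At ℚ (toSite r) (upF (rec23 d L)) (recW d L) (rec12 d L) L μ 0 : recAlg (SB d L)) :
        Matrix (Idx (SB d L)) (Idx (SB d L)) ℚ) with hX
    have hpt : ∀ w : SB d L × SB d L × SB d L,
        |(vh2Tab (toSite r) L μ 0 (w.1 : Bond d) (w.2.1 : Bond d) (w.2.2 : Bond d) : ℝ)| = |(X Idx.nil (Idx.three w.2.1 w.2.2 w.1) : ℝ)| := by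
      intro w
      have h := vh2Tab_eq_entry (toSite r) L μ (w.2.1, w.2.2, w.1)
      dsimp only at h
      rw [← hX] at h
      rw [h]
    have hs : ∑ w : SB d L × SB d L × SB d L, |(X Idx.nil (Idx.three w.2.1 w.2.2 w.1) : ℝ)|
        = ∑ w : SB d L × SB d L × SB d L, |(X Idx.nil (Idx.three w.1 w.2.1 w.2.2) : ℝ)| :=
      Fintype.sum_equiv e _ _ fun _ => rfl
    rw [Finset.sum_congr rfl fun w _ => hpt w, hs]
    exact sum_abs_entry_T2_le hL hr μ
  unfold vh2Abs
  calc ∑ μ : Fin d, ∑ p ∈ (bondSet d L ×ˢ bondSet d L) ×ˢ bondSet d L, |(vh2Tab (toSite r) L μ 0 p.1.1 p.1.2 p.2 : ℝ)|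
      ≤ ∑ _μ : Fin d, 50000 * (ell d L : ℝ) ^ 3 := Finset.sum_le_sum fun μ _ => hμ μ
    _ = 50000 * d * (ell d L : ℝ) ^ 3 := by
        rw [Finset.sum_const, Finset.card_univ, Fintype.card_fin, nsmul_eq_mul]; ring

/-- [folklore] **AT THE CENTRED ROOT**: `vh2Abs (ctr d n) n ≤ 50000 · d · ((2d+2)·n)³` for `1 ≤ n` (at the road's `d = 4`: `≤ 2·10⁸ · n³`). -/
theorem vh2Abs_ctr_le {n : ℕ} (hn : 1 ≤ n) :
    vh2Abs (ctr d n) n ≤ 50000 * d * (((2 * d + 2) * n : ℕ) : ℝ) ^ 3 :=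
  vh2Abs_le hn (ctrOff_mem_box (d := d) hn)

/-- [folklore] **AT THE ROAD's `d = 4`, the numeral multiplied out**: `vh2Abs (ctr 4 n) n ≤ 2·10⁸ · n³` (`1 ≤ n` via `[NeZero n]` — the socket shape of the
row consumers, cf. «COMB-MIXED-TABLE-MASS» `mixAbs_ctr4_le`). -/
theorem vh2Abs_ctr4_le (n : ℕ) [NeZero n] : vh2Abs (ctr 4 n) n ≤ 200000000 * (n : ℝ) ^ 3 := by
  have h := vh2Abs_ctr_le (d := 4) (Nat.one_le_iff_ne_zero.2 (NeZero.ne n))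
  calc vh2Abs (ctr 4 n) n ≤ 50000 * (4 : ℕ) * (((2 * 4 + 2) * n : ℕ) : ℝ) ^ 3 := h
    _ = 200000000 * (n : ℝ) ^ 3 := by push_cast; ring

end Mass

end Summit.QuantumFields.BalabanUV.Beta.D1BFx.T2TableMass

end
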